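import Summits.AtomisticToContinuum.Crystallization.Theorems.HullExactificationCascadeZeroDefectDensityCapAtomsAux
import HarnessLib

/-!
# Cap atoms exist over every soft square (birth line of `ZeroDefectDensity`, stub `stub_capAtoms`)
# (route `HullExactificationCascade`, crux `ZeroDefectDensity`, stmt-AtomisticToContinuum-12086; lead c4)

The registered stub `stub_capAtoms` of `Cruxes/ZeroDefectDensity/Lines/birth.lean`, verbatim: under
two-shell `1/4000`-soft kissing about `u ∈ S`, with the `LocalHalesKernel` conclusion (soft contact
graph ≅ fcc or hcp pattern graph) at `u` and at every soft neighbour of `u`, and given both halves of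
the link lemma (`stub_linkLemma`, taken as hypotheses), every induced soft 4-cycle `z₁ z₂ z₃ z₄` of the
soft shell of `u` has a common soft contact `w ≠ u`.

Proof (files `…CapAtomsPattern`, `…CapAtomsAux`):
1. Euler's quadrilateral inequality on `z₁ z₂ z₃ z₄` (sides `≤ 1 + 1/4000`, diagonals `≥ 131/100` by
   the gap): both diagonals have square `< 64/25`.
2. In the charted shell of `z₁` the points `u, z₂, z₄` are a vertex and two non-adjacent neighbours of
   it at square distance `< 64/25`, hence (link bound) a square-type pair: its fourth corner `x` is a
   soft contact of `z₁, z₂, z₄` and not of `u` (`chart_corner`).  Likewise `x'` from the shell of `z₃`.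
3. `u, z₁, z₃, x, x'` are common soft contacts of `z₂` and `z₄` (`dist z₂ z₄ ≥ 131/100`), so by Euler
   every two of them are at square distance `< 64/25`; read in the charted shell of `z₂` this is the
   closing configuration of the pattern graph (`chart_close5`), whence `x = x'`.
4. `w := x` is a soft contact of all four `zᵢ` (tolerance `1/400 → 1/4000` below the gap).

The hypothesis at `u` itself (H2) is not needed. No new definitions. [folklore]
-/

noncomputable section

namespace Summit.AtomisticToContinuum.Crystallization.Theorems.ZeroDefectDensityBirth

open Literature.Geometry.DiscreteGeometry

/-- **Registered stub `stub_capAtoms` (line `birth`, crux `ZeroDefectDensity`): cap atoms exist.**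
Under two-shell `1/4000`-soft kissing about `u ∈ S`, with fcc/hcp soft contact graphs at `u` and at its
soft neighbours and the link lemma (both types) as hypotheses, every induced soft 4-cycle of the shell of
`u` has a common soft contact `w ≠ u` (the octahedral interstitial over the square). [folklore] -/
theorem stub_capAtoms : ∀ (S : Set (EuclideanSpace ℝ (Fin 3))) (u : EuclideanSpace ℝ (Fin 3)), u ∈ S → (∀ v ∈ S, dist u v ≤ 13 / 5 → ((∀ w ∈ S, w ≠ v → 1 - 1 / 4000 ≤ dist v w ∧ (dist v w ≤ 1 + 1 / 4000 ∨ 131 / 100 ≤ dist v w)) ∧ {w ∈ S | w ≠ v ∧ dist v w ≤ 1 + 1 / 4000}.ncard = 12)) → ((∃ e : {w : EuclideanSpace ℝ (Fin 3) // w ∈ S ∧ w ≠ u ∧ dist u w ≤ 1 + 1 / 400} ≃ {q : EuclideanSpace ℝ (Fin 3) // q ∈ Literature.Geometry.DiscreteGeometry.fccKissingPattern}, ∀ w w' : {w : EuclideanSpace ℝ (Fin 3) // w ∈ S ∧ w ≠ u ∧ dist u w ≤ 1 + 1 / 400}, w ≠ w' → (dist w.1 w'.1 ≤ 1 + 1 /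 400 ↔ dist (e w).1 (e w').1 = 1)) ∨ (∃ e : {w : EuclideanSpace ℝ (Fin 3) // w ∈ S ∧ w ≠ u ∧ dist u w ≤ 1 + 1 / 400} ≃ {q : EuclideanSpace ℝ (Fin 3) // q ∈ Literature.Geometry.DiscreteGeometry.hcpKissingPattern}, ∀ w w' : {w : EuclideanSpace ℝ (Fin 3) // w ∈ S ∧ w ≠ u ∧ dist u w ≤ 1 + 1 / 400}, w ≠ w' → (dist w.1 w'.1 ≤ 1 + 1 / 400 ↔ dist (e w).1 (e w').1 = 1))) → (∀ z ∈ S, z ≠ u → dist u z ≤ 1 + 1 / 4000 → ((∃ e : {w : EuclideanSpace ℝ (Fin 3) // w ∈ S ∧ w ≠ z ∧ dist z w ≤ 1 + 1 / 400} ≃ {q : EuclideanSpace ℝ (Fin 3) // q ∈ Literature.Geometry.DiscreteGeometry.fccKissingPattern}, ∀ w w' : {w : EuclideanSpace ℝ (Fin 3) // w ∈ S ∧ w ≠ z ∧ dist z w ≤ 1 + 1 / 400}, w ≠ w' → (dist w.1 w'.1 ≤ 1 + 1 / 400 ↔ dist (e w).1 (e w').1 = 1)) ∨ (∃ e : {w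 : EuclideanSpace ℝ (Fin 3) // w ∈ S ∧ w ≠ z ∧ dist z w ≤ 1 + 1 / 400} ≃ {q : EuclideanSpace ℝ (Fin 3) // q ∈ Literature.Geometry.DiscreteGeometry.hcpKissingPattern}, ∀ w w' : {w : EuclideanSpace ℝ (Fin 3) // w ∈ S ∧ w ≠ z ∧ dist z w ≤ 1 + 1 / 400}, w ≠ w' → (dist w.1 w'.1 ≤ 1 + 1 / 400 ↔ dist (e w).1 (e w').1 = 1)))) → (∀ (η : ℝ) (p c n₁ n₂ n₃ n₄ : EuclideanSpace ℝ (Fin 3)), 0 ≤ η → η ≤ 1 / 1000 → 1 - η ≤ dist c p → dist c p ≤ 1 + η → 1 - η ≤ dist p n₁ → dist p n₁ ≤ 1 + η → 1 - η ≤ dist p n₂ → dist p n₂ ≤ 1 + η → 1 - η ≤ dist p n₃ → dist p n₃ ≤ 1 + η → 1 - η ≤ dist p n₄ → dist p n₄ ≤ 1 + η → 1 - η ≤ dist c n₁ → dist c n₁ ≤ 1 + η → 1 - η ≤ dist c n₂ → dist c n₂ ≤ 1 + η → 1 - η ≤ dist c n₃ → dist c n₃ ≤ 1 + η → 1 - η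 ≤ dist c n₄ → dist c n₄ ≤ 1 + η → 1 - η ≤ dist n₁ n₂ → dist n₁ n₂ ≤ 1 + η → 1 - η ≤ dist n₃ n₄ → dist n₃ n₄ ≤ 1 + η → 131 / 100 ≤ dist n₁ n₃ → 131 / 100 ≤ dist n₂ n₄ → 131 / 100 ≤ dist n₂ n₃ → 131 / 100 ≤ dist n₄ n₁ → (17 / 10 ≤ dist n₁ n₃ ∧ 17 / 10 ≤ dist n₂ n₄) ∨ (17 / 10 ≤ dist n₂ n₃ ∧ 17 / 10 ≤ dist n₄ n₁)) → (∀ (η : ℝ) (p c n₁ n₂ n₃ n₄ : EuclideanSpace ℝ (Fin 3)), 0 ≤ η → η ≤ 1 / 1000 → 1 - η ≤ dist c p → dist c p ≤ 1 + η → 1 - η ≤ dist p n₁ → dist p n₁ ≤ 1 + η → 1 - η ≤ dist p n₂ → dist p n₂ ≤ 1 + η → 1 - η ≤ dist p n₃ → dist p n₃ ≤ 1 + η → 1 - η ≤ dist p n₄ → dist p n₄ ≤ 1 + η → 1 - η ≤ dist c n₁ → dist c n₁ ≤ 1 + η → 1 - η ≤ dist c n₂ → dist c n₂ ≤ 1 +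 η → 1 - η ≤ dist c n₃ → dist c n₃ ≤ 1 + η → 1 - η ≤ dist c n₄ → dist c n₄ ≤ 1 + η → 1 - η ≤ dist n₁ n₂ → dist n₁ n₂ ≤ 1 + η → 1 - η ≤ dist n₂ n₃ → dist n₂ n₃ ≤ 1 + η → 131 / 100 ≤ dist n₁ n₃ → 131 / 100 ≤ dist n₂ n₄ → 131 / 100 ≤ dist n₃ n₄ → 131 / 100 ≤ dist n₄ n₁ → 8 / 5 ≤ dist n₁ n₃ ∧ 17 / 10 ≤ dist n₂ n₄) → (∀ z₁ ∈ S, ∀ z₂ ∈ S, ∀ z₃ ∈ S, ∀ z₄ ∈ S, z₁ ≠ u → z₂ ≠ u → z₃ ≠ u → z₄ ≠ u → dist u z₁ ≤ 1 + 1 / 4000 → dist u z₂ ≤ 1 + 1 / 4000 → dist u z₃ ≤ 1 + 1 / 4000 → dist u z₄ ≤ 1 + 1 / 4000 → dist z₁ z₂ ≤ 1 + 1 / 4000 → dist z₂ z₃ ≤ 1 + 1 / 4000 → dist z₃ z₄ ≤ 1 + 1 / 4000 → dist z₄ z₁ ≤ 1 + 1 / 4000 → ¬ dist z₁ z₃ ≤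 1 + 1 / 4000 → ¬ dist z₂ z₄ ≤ 1 + 1 / 4000 → ∃ w ∈ S, w ≠ u ∧ dist w z₁ ≤ 1 + 1 / 4000 ∧ dist w z₂ ≤ 1 + 1 / 4000 ∧ dist w z₃ ≤ 1 + 1 / 4000 ∧ dist w z₄ ≤ 1 + 1 / 4000) := by
  intro S u hu hS _hIsoU hIsoZ linkA linkB z₁ hz₁ z₂ hz₂ z₃ hz₃ z₄ hz₄ h1u h2u h3u h4u hu1 hu2 hu3 hu4
    h12 h23 h34 h41 h13 h24
  -- the separation half of soft kissing
  have hsep : ∀ v ∈ S, dist u v ≤ 13 / 5 → ∀ w ∈ S, w ≠ v →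
      1 - 1 / 4000 ≤ dist v w ∧ (dist v w ≤ 1 + 1 / 4000 ∨ 131 / 100 ≤ dist v w) :=
    fun v hv hd => (hS v hv hd).1
  -- bookkeeping: radii and tolerances
  have r1 : dist u z₁ ≤ 13 / 5 := by linarith
  have r2 : dist u z₂ ≤ 13 / 5 := by linarith
  have r3 : dist u z₃ ≤ 13 / 5 := by linarith
  have r4 : dist u z₄ ≤ 13 / 5 := by linarith
  have wk : ∀ {a b : EuclideanSpace ℝ (Fin 3)}, dist a b ≤ 1 + 1 / 4000 → dist a b ≤ 1 + 1 / 400 :=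
    fun h => by linarith
  have wk' : ∀ {a b : EuclideanSpace ℝ (Fin 3)}, dist a b ≤ 1 + 1 / 4000 → dist b a ≤ 1 + 1 / 400 :=
    fun h => by rw [dist_comm]; linarith
  -- distinctness of the corners
  have hz13 : z₁ ≠ z₃ := fun h => h13 (by rw [h, dist_self]; norm_num)
  have hz24 : z₂ ≠ z₄ := fun h => h24 (by rw [h, dist_self]; norm_num)
  have hz12 : z₁ ≠ z₂ := fun h => h13 (by rw [h]; exact h23)
  have hz14 : z₁ ≠ z₄ := fun h => h13 (by rw [h, dist_comm]; exact h34)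
  have hz32 : z₃ ≠ z₂ := fun h => h13 (by rw [h]; exact h12)
  have hz34 : z₃ ≠ z₄ := fun h => h13 (by rw [h, dist_comm]; exact h41)
  -- the two diagonals are far (gap) and short (Euler)
  have f13 : 131 / 100 ≤ dist z₁ z₃ := soft_far hsep hz₁ r1 hz₃ hz13.symm h13
  have f24 : 131 / 100 ≤ dist z₂ z₄ := soft_far hsep hz₂ r2 hz₄ hz24.symm h24
  have s24 : dist z₂ z₄ ^ 2 < 64 / 25 := sq_dist_lt_of_quad z₁ z₂ z₃ z₄ h12 h23 h34 h41 f13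
  have s13 : dist z₁ z₃ ^ 2 < 64 / 25 :=
    sq_dist_lt_of_quad z₄ z₁ z₂ z₃ h41 h12 h23 h34 (by rw [dist_comm]; exact f24)
  -- charts at z₁, z₂, z₃
  obtain ⟨adj₁, idx₁, hidx₁, hirr₁, hlink₁, -⟩ := exists_chart (hIsoZ z₁ hz₁ h1u hu1)
  obtain ⟨adj₂, idx₂, hidx₂, hirr₂, hlink₂, hcl₂⟩ := exists_chart (hIsoZ z₂ hz₂ h2u hu2)
  obtain ⟨adj₃, idx₃, hidx₃, hirr₃, hlink₃, -⟩ := exists_chart (hIsoZ z₃ hz₃ h3u hu3)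
  have hup1 : dist u z₁ ≤ 11 / 10 := by linarith
  have hup2 : dist u z₂ ≤ 11 / 10 := by linarith
  have hup3 : dist u z₃ ≤ 11 / 10 := by linarith
  -- Step 2: the fourth corner `x` of the square `u z₂ · z₄` in the shell of `z₁`
  obtain ⟨x, hxS, hx1, hd1x, hxu, hdx2, hdx4, hdxu⟩ :=
    chart_corner hsep hz₁ hup1 idx₁ hidx₁ hirr₁ hlink₁ linkA linkB
      hu h1u.symm (wk' hu1) hz₂ hz12.symm (wk h12) hz₄ hz14.symm (wk' h41)
      h2u.symm h4u.symm hz24 (wk hu2) (wk hu4) (fun h => by linarith) s24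
  -- Step 3: the fourth corner `x'` of the same square in the shell of `z₃`
  obtain ⟨x', hyS, hy3, hd3y, hyu, hdy2, hdy4, hdyu⟩ :=
    chart_corner hsep hz₃ hup3 idx₃ hidx₃ hirr₃ hlink₃ linkA linkB
      hu h3u.symm (wk' hu3) hz₂ hz32.symm (wk' h23) hz₄ hz34.symm (wk h34)
      h2u.symm h4u.symm hz24 (wk hu2) (wk hu4) (fun h => by linarith) s24
  -- the new contacts, sharpened below the gap
  have hx2 : x ≠ z₂ := by
    rintro rfl
    linarith
  have hx4 : x ≠ z₄ := by
    rintro rfl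
    rw [dist_comm] at hdx2
    linarith
  have hy2 : x' ≠ z₂ := by
    rintro rfl
    linarith
  have hy4 : x' ≠ z₄ := by
    rintro rfl
    rw [dist_comm] at hdy2
    linarith
  have ex1 : dist z₁ x ≤ 1 + 1 / 4000 := soft_contact hsep hz₁ r1 hxS hx1 hd1x
  have ex2 : dist z₂ x ≤ 1 + 1 / 4000 := soft_contact hsep hz₂ r2 hxS hx2 (by rw [dist_comm]; exact hdx2)
  have ex4 : dist z₄ x ≤ 1 + 1 / 4000 := soft_contact hsep hz₄ r4 hxS hx4 (by rw [dist_comm]; exact hdx4)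
  have ey3 : dist z₃ x' ≤ 1 + 1 / 4000 := soft_contact hsep hz₃ r3 hyS hy3 hd3y
  have ey2 : dist z₂ x' ≤ 1 + 1 / 4000 := soft_contact hsep hz₂ r2 hyS hy2 (by rw [dist_comm]; exact hdy2)
  have ey4 : dist z₄ x' ≤ 1 + 1 / 4000 := soft_contact hsep hz₄ r4 hyS hy4 (by rw [dist_comm]; exact hdy4)
  -- Step 4: common soft contacts of `z₂, z₄` are pairwise short (Euler); the closing configuration
  have sux : dist u x ^ 2 < 64 / 25 :=
    sq_dist_lt_of_quad z₂ u z₄ x (by rw [dist_comm]; exact hu2) hu4 ex4 (by rw [dist_comm]; exact ex2) f24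
  have suy : dist u x' ^ 2 < 64 / 25 :=
    sq_dist_lt_of_quad z₂ u z₄ x' (by rw [dist_comm]; exact hu2) hu4 ey4 (by rw [dist_comm]; exact ey2) f24
  have sxy : dist x x' ^ 2 < 64 / 25 :=
    sq_dist_lt_of_quad z₂ x z₄ x' ex2 (by rw [dist_comm]; exact ex4) ey4 (by rw [dist_comm]; exact ey2) f24
  have hxx : x = x' :=
    chart_close5 hsep hz₂ hup2 idx₂ hidx₂ hirr₂ hlink₂ linkA linkB hcl₂
      hu h2u.symm (wk' hu2) hz₁ hz12 (wk' h12) hz₃ hz32 (wk h23)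
      hxS hx2 (wk ex2) hyS hy2 (wk ey2)
      h1u.symm (wk hu1) h3u.symm (wk hu3) hz13 (fun h => by linarith)
      hx1 (by rw [dist_comm]; exact hd1x) hxu hdxu
      hy3 (by rw [dist_comm]; exact hd3y) hyu hdyu
      s13 sux suy (fun _ => sxy)
  -- Step 5: `w := x` caps the cycle
  refine ⟨x, hxS, hxu, ?_, ?_, ?_, ?_⟩
  · rw [dist_comm]; exact ex1
  · rw [dist_comm]; exact ex2
  · rw [hxx, dist_comm]; exact ey3
  · rw [dist_comm]; exact ex4

end Summit.AtomisticToContinuum.Crystallization.Theorems.ZeroDefectDensityBirth
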